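import Literature.Probability.Moments.HutchinsonTraceEstimator
import Literature.Analysis.Matrix.LanczosFunctionBounds
import HarnessLib

/-!
# Stochastic Lanczos quadrature: for polynomials of degree `≤ 2k + 1` it IS Hutchinson's
# estimator applied to `p(A)` (exact mean `tr p(A)`, same single-probe variance)

Topic `Probability/Moments`; a bridge between `HutchinsonTraceEstimator.lean` (Rademacher probes,
`2^{−n} Σ_s zᵀ B z = tr B`, single-sample variance `2(‖B‖_F² − Σ_i B_ii²)` for symmetric `B`) and
`Analysis/Matrix/LanczosGaussQuadrature.lean` / `LanczosFunctionBounds.lean` (the Lanczos process started at `z/‖z‖` computes the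
Gauss rule of the spectral measure of `(A, z)`: `zᵀ p(A) z = ‖z‖² (p(J))₁₁ = ‖z‖² Σ_l τ_l² p(θ_l)` for
`deg p ≤ 2k + 1`, `J = Vᵀ A V` the `(k+1) × (k+1)` Lanczos matrix, `θ_l` its eigenvalues (Ritz
values), `τ_l` the first components of its normalised eigenvectors).  PUBLISHED RESULTS with our
proofs; no definition and no named fact (`def … : Prop`) is introduced (D-0026).

HONEST FRAMING: exact (Metropolis-corrected) sampling algorithms for lattice gauge theory; figures
of merit are autocorrelation/cost numbers at stated couplings and volumes; no continuum-physics claim.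

## Sources (read on the materialised texts) and what is taken

* T. Chen, T. Trogdon, S. Ubaru, *Analysis of stochastic Lanczos quadrature for spectrum
  approximation*, ICML 2021, PMLR 139 [ChenTrogdonUbaru2021] (held text `paper:arxiv-2105.06595`,
  chunks p0001–p0004, p0009, p0011): §1 "the cumulative empirical spectral measure (CESM) …
  `Φ[A]` … can be approximated by the average of weighted CESMs `Ψ[A, v] = Σ_i |v^T u_i|² 1[λ_i ≤ x]`
  … `E[Ψ[A, v]] = Φ[A]` when `v` is drawn uniformly from the unit sphere"; §4.2 Def. 5 (the degree-`k`
  Gauss quadrature rule `[Ψ]^{gq}_k = Σ_i ω_i δ_{θ_i}`, nodes the eigenvalues of the Lanczos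
  tridiagonal matrix, weights the squared first components of its unit eigenvectors) and Prop. 1
  ("`[Ψ]^{gq}_k` integrates polynomials of degree `2k − 1` exactly against `Ψ`"); the SLQ output is
  the average over the probes of `[Ψ[A, v_j]]^{gq}_k` (Algorithm 1 / §1, "SLQ").
* A. K. Saibaba, A. Alexanderian, I. C. F. Ipsen, Numer. Math. 137 (2017) [SaibabaAlexanderianIpsen2017]
  §1, §2.3 (Hutchinson's Rademacher estimator, its unbiasedness and single-sample variance) — as
  formalised in `HutchinsonTraceEstimator.lean`.
* G. H. Golub, C. F. Van Loan, *Matrix Computations*, 4th ed. (2013) [GolubVanLoan2013] §10.2.4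
  (`uᵀ f(A) u ≈ ‖u‖² e₁ᵀ f(T_k) e₁`, exact for `deg ≤ 2k − 1`) — as formalised in
  `LanczosGaussQuadrature.lean`.

## What is formalised (`A : Matrix ι ι ℝ` symmetric, `n = |ι|`, Rademacher probes `z = signVec s`
realised by the uniform distribution on the `2^n` sign patterns `s : Finset ι` as in
`HutchinsonTraceEstimator.lean`; for every pattern `s` a Lanczos relation
`A V_s = V_s J_s + r_s e_{k+1}ᵀ` with `k + 1` orthonormal columns started at `z/√n`)

* `trace_aeval_eq_sum` — `tr p(M) = Σ_μ p(λ_μ)` (any `RCLike 𝕜`; with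
  `LanczosGauss.sum_spectralWeight_single`: averaged over the coordinate vectors the spectral
  measures of `(M, e_i)` give CTU's CESM `Φ[M]`).
* `sample_eq_dotProduct` — `Hutchinson.sample B s = zᵀ (B z)`.
* `signVec_dotProduct_self` (private helper) — `zᵀz = n`.
* **`slq_sample_eq`** — for `deg p ≤ 2k + 1` the SLQ sample `n · (p(J_s))₁₁` EQUALS the Hutchinson
  sample `zᵀ p(A) z` (GVL §10.2.4 / CTU Prop. 1 applied probe by probe).
* **`slq_sample_eq_gauss`** — the same written as the printed Gauss rule
  `n · Σ_l τ_l(s)² p(θ_l(s))` (CTU Def. 5).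
* **`slq_mean_eq_trace`** — exactness in the mean: `2^{−n} Σ_s n (p(J_s))₁₁ = tr p(A)` for
  `deg p ≤ 2k + 1` (Hutchinson unbiasedness ∘ Gauss exactness; CTU §1 `E[Ψ[A,v]] = Φ[A]` with
  Prop. 1, for Rademacher instead of spherical probes).
* **`slq_mean_eq_sum_eigenvalues`** — the same in CTU's normalisation: the averaged Gauss rules have
  the moments of `Φ[A]` (`Σ_μ p(λ_μ)`) up to order `2k + 1`.
* **`slq_variance_eq`** — and the single-probe variance of the SLQ sample is Hutchinson's,
  `2^{−n} Σ_s (n (p(J_s))₁₁ − tr p(A))² = 2(Σ_{i,j} p(A)_ij² − Σ_i p(A)_ii²)`.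

* **`hutchinson_mean_log`**, **`sum_log_le_slq_mean`**, **`slqRadau_mean_le_sum_log`** — for
  `f = log` (positive definite `A`): the exact Hutchinson mean of `zᵀ log(A) z` is
  `log det A = Σ_μ log λ_μ`, and the `(k+1)`-step SLQ estimate of it OVER-estimates in exact
  expectation over the probes (Gauss rule = upper bound probe by probe,
  `LanczosFunctionBounds.lean`), while the Gauss–Radau variant (prescribed node `a ≤ λ_min`)
  UNDER-estimates: `2^{−n} Σ_s n (log J'_s)₁₁ ≤ log det A ≤ 2^{−n} Σ_s n (log J_s)₁₁`.

So for polynomial `f` of degree `≤ 2k + 1` the `(k+1)`-step SLQ estimator carries NO quadrature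
error at all — only the Monte Carlo error of Hutchinson's estimator for `B = f(A)`; for general `f`
the additional (deterministic, per-probe) error is the Gauss quadrature remainder, whose SIGN for
`log`, `λ^{-1/2}`, `1/λ`, `1/λ²` is in `LanczosFunctionBounds.lean` / `LanczosGaussQuadrature.lean` /
`CGErrorGaussRemainder.lean` — hence the two-sided `log det` statement above.  NOT formalised:
spherical or Gaussian probes, the analytic-`f` error bounds of Ubaru–Chen–Saad (Bernstein ellipses)
and the Kolmogorov–Smirnov-distance bounds of CTU Thm. 2, finite precision.

Prior art in the tree (nothing restated): `HutchinsonTraceEstimator` (mean and variance of one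
Rademacher probe), `StochasticTraceEstimator` / `HutchinsonSampleMean` / `HutchinsonHoeffdingCount`
(sample means and tails), `LanczosGaussQuadrature` (the Gauss rule from the Lanczos matrix),
`Analysis/Quadrature/GaussTypeExactness` (Gauss-type rules for weight functions on an interval).

Context (cell pub-lqcd, HOME/R2-SCOPE.md §3 E5/E6: stochastic estimates of `tr f(D†D)` —
`log det` differences, `tr (D†D)⁻¹` — inside exact fermion algorithms are SLQ estimates; this file
pins down exactly which part of their error is statistical and which is quadrature).  No
continuum-physics claim.
-/

noncomputable section

open Finset Matrix Polynomial

namespace Literature.Probability.Moments.SLQ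

open Literature.Combinatorics.Enumerative (signVec signVec_apply)
open Literature.Analysis.Matrix.LanczosGauss

section Spectral

variable {𝕜 : Type*} [RCLike 𝕜] {m : Type*} [Fintype m] [DecidableEq m] {M : Matrix m m 𝕜}

/-- **`tr p(M) = Σ_μ p(λ_μ)`** (`= n ∫ p dΦ[M]`, CTU §1 "`Φ[A]` … CESM"): the trace of a polynomial
matrix function is the sum of the polynomial over the eigenvalues.
[cite: ChenTrogdonUbaru2021, §1] [cite: GolubVanLoan2013, §10.2.1 (10.2.6)] -/
theorem trace_aeval_eq_sum (hM : M.IsHermitian) (p : 𝕜[X]) :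
    (aeval M p).trace = ∑ μ, aeval (hM.eigenvalues μ : 𝕜) p := by
  simp only [Matrix.trace, Matrix.diag_apply, aeval_apply_eq_sum hM]
  rw [Finset.sum_comm]
  refine sum_congr rfl fun μ _ => ?_
  rw [← Finset.sum_mul, ← RCLike.ofReal_sum, sum_spectralWeight_single, RCLike.ofReal_one, one_mul]

end Spectral

variable {ι : Type*} [Fintype ι] [DecidableEq ι]

/-- Hutchinson's sample is the quadratic form `zᵀ B z`. [cite: SaibabaAlexanderianIpsen2017, §1] -/
theorem sample_eq_dotProduct (B : Matrix ι ι ℝ) (s : Finset ι) :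
    Hutchinson.sample B s = signVec s ⬝ᵥ (B *ᵥ signVec s) := by
  unfold Hutchinson.sample
  simp only [dotProduct, mulVec, Finset.mul_sum]
  refine sum_congr rfl fun i _ => sum_congr rfl fun j _ => by ring

omit [Fintype ι] in
/-- `z_i² = 1`. [folklore] -/
private theorem signVec_mul_self (s : Finset ι) (i : ι) :
    (signVec s i : ℝ) * signVec s i = 1 := by
  rw [signVec_apply]; split_ifs <;> norm_num

/-- `zᵀ z = n` for a sign vector. [folklore] -/
private theorem signVec_dotProduct_self (s : Finset ι) :
    signVec s ⬝ᵥ signVec s = (Fintype.card ι : ℝ) := by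
  simp only [dotProduct, signVec_mul_self, sum_const, card_univ, nsmul_eq_mul, mul_one]

variable {k : ℕ} {A : Matrix ι ι ℝ} {V : Finset ι → Matrix ι (Fin (k + 1)) ℝ}
  {J : Finset ι → Matrix (Fin (k + 1)) (Fin (k + 1)) ℝ} {r : Finset ι → ι → ℝ} {c : ℝ}

/-- **Probe by probe, SLQ = Hutchinson for `deg p ≤ 2k + 1`**: if the Lanczos process with `k + 1`
steps is run from `z/‖z‖` (`z = c · v₁`), then `n · (p(J))₁₁ = zᵀ p(A) z`.
[cite: GolubVanLoan2013, §10.2.4] [cite: ChenTrogdonUbaru2021, §4.2 Prop. 1] -/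
theorem slq_sample_eq (hA : A.IsHermitian) (hL : ∀ s, LanczosRelation A (V s) (J s) (r s))
    (hz : ∀ s, signVec s = c • (V s).col 0) {p : ℝ[X]} (hp : p.natDegree ≤ 2 * k + 1)
    (s : Finset ι) :
    (Fintype.card ι : ℝ) * aeval (J s) p 0 0 = Hutchinson.sample (aeval A p) s := by
  rw [sample_eq_dotProduct, ← signVec_dotProduct_self s]
  have h := (hL s).aeval_eq_of_eq_smul hA hp (hz s)
  simpa only [star_trivial] using h.symm

/-- The same with the printed Gauss rule `Σ_l τ_l² p(θ_l)` of the Lanczos matrix (CTU Def. 5: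
nodes `θ_l` = eigenvalues of `J`, weights `τ_l²` = squared first components of its unit
eigenvectors, here `spectralWeight _ e₁ l`). [cite: ChenTrogdonUbaru2021, §4.2 Def. 5, Prop. 1] -/
theorem slq_sample_eq_gauss (hA : A.IsHermitian) (hL : ∀ s, LanczosRelation A (V s) (J s) (r s))
    (hz : ∀ s, signVec s = c • (V s).col 0) {p : ℝ[X]} (hp : p.natDegree ≤ 2 * k + 1)
    (s : Finset ι) :
    (Fintype.card ι : ℝ) * ∑ l, spectralWeight ((hL s).isHermitian_J hA) (Pi.single 0 1) l
        * p.eval (((hL s).isHermitian_J hA).eigenvalues l)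
      = Hutchinson.sample (aeval A p) s := by
  rw [← slq_sample_eq hA hL hz hp s, aeval_apply_eq_sum ((hL s).isHermitian_J hA)]
  simp only [RCLike.ofReal_real_eq_id, id_eq, coe_aeval_eq_eval]

/-- **SLQ is exact in the mean for `deg p ≤ 2k + 1`**: averaging the `(k+1)`-step SLQ sample over
the `2^n` Rademacher probes gives `tr p(A)` exactly.
[cite: ChenTrogdonUbaru2021, §1, §4.2 Prop. 1] [cite: SaibabaAlexanderianIpsen2017, §1] -/
theorem slq_mean_eq_trace (hA : A.IsHermitian) (hL : ∀ s, LanczosRelation A (V s) (J s) (r s))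
    (hz : ∀ s, signVec s = c • (V s).col 0) {p : ℝ[X]} (hp : p.natDegree ≤ 2 * k + 1) :
    ((2 : ℝ) ^ Fintype.card ι)⁻¹ * ∑ s : Finset ι, (Fintype.card ι : ℝ) * aeval (J s) p 0 0
      = (aeval A p).trace := by
  simp_rw [slq_sample_eq hA hL hz hp]
  exact Hutchinson.hutchinson_mean _

/-- **The averaged Gauss rules reproduce the eigenvalue sums** (CTU §1 + Prop. 1 in the
normalisation `tr p(A) = Σ_μ p(λ_μ) = n ∫ p dΦ[A]`): for `deg p ≤ 2k + 1`,
`2^{−n} Σ_s n Σ_l τ_l(s)² p(θ_l(s)) = Σ_μ p(λ_μ(A))` — the `2^n (k+1)`-atom measure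
`2^{−n} Σ_s Σ_l τ_l(s)² δ_{θ_l(s)}` has the same moments as `Φ[A]` up to order `2k + 1`.
[cite: ChenTrogdonUbaru2021, §1, §4.2 Def. 5, Prop. 1] -/
theorem slq_mean_eq_sum_eigenvalues (hA : A.IsHermitian)
    (hL : ∀ s, LanczosRelation A (V s) (J s) (r s)) (hz : ∀ s, signVec s = c • (V s).col 0)
    {p : ℝ[X]} (hp : p.natDegree ≤ 2 * k + 1) :
    ((2 : ℝ) ^ Fintype.card ι)⁻¹ * ∑ s : Finset ι, (Fintype.card ι : ℝ)
        * ∑ l, spectralWeight ((hL s).isHermitian_J hA) (Pi.single 0 1) l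
          * p.eval (((hL s).isHermitian_J hA).eigenvalues l)
      = ∑ μ, p.eval (hA.eigenvalues μ) := by
  simp_rw [slq_sample_eq_gauss hA hL hz hp]
  rw [Hutchinson.hutchinson_mean, trace_aeval_eq_sum hA]
  simp only [RCLike.ofReal_real_eq_id, id_eq, coe_aeval_eq_eval]

/-- `p(A)ᵀ = p(Aᵀ)`. [folklore] -/
private theorem transpose_aeval (B : Matrix ι ι ℝ) (p : ℝ[X]) : (aeval B p)ᵀ = aeval Bᵀ p := by
  rw [aeval_eq_sum_range, aeval_eq_sum_range, transpose_sum]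
  simp only [transpose_smul, transpose_pow]

/-- `p(A)` is symmetric when `A` is. [folklore] -/
private theorem aeval_isSymm (hA : A.IsHermitian) (p : ℝ[X]) : (aeval A p).IsSymm := by
  have hAT : Aᵀ = A := by simpa only [conjTranspose_eq_transpose_of_trivial] using hA.eq
  show (aeval A p)ᵀ = aeval A p
  rw [transpose_aeval, hAT]

/-- **The single-probe variance of the SLQ sample is Hutchinson's** (for `deg p ≤ 2k + 1`):
`2^{−n} Σ_s (n (p(J_s))₁₁ − tr p(A))² = 2(Σ_{i,j} p(A)_ij² − Σ_i p(A)_ii²)` — no quadrature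
contribution. [cite: SaibabaAlexanderianIpsen2017, §2.3] [cite: ChenTrogdonUbaru2021, §4.2 Prop. 1] -/
theorem slq_variance_eq (hA : A.IsHermitian) (hL : ∀ s, LanczosRelation A (V s) (J s) (r s))
    (hz : ∀ s, signVec s = c • (V s).col 0) {p : ℝ[X]} (hp : p.natDegree ≤ 2 * k + 1) :
    ((2 : ℝ) ^ Fintype.card ι)⁻¹
        * ∑ s : Finset ι, ((Fintype.card ι : ℝ) * aeval (J s) p 0 0 - (aeval A p).trace) ^ 2
      = 2 * (∑ i, ∑ j, aeval A p i j ^ 2 - ∑ i, aeval A p i i ^ 2) := by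
  simp_rw [slq_sample_eq hA hL hz hp]
  exact Hutchinson.hutchinson_variance_of_symm _ (aeval_isSymm hA p)

/-! ### General `f`: for `deg > 2k + 1` the quadrature error has a SIGN — the Rademacher-SLQ
estimate of `log det A` with `k + 1` Gauss nodes over-estimates in exact expectation, the
Gauss–Radau variant under-estimates -/

/-- `log det A = Σ_μ log λ_μ` is the exact Hutchinson mean of the quadratic form of `log A`:
`2^{−n} Σ_s zᵀ log(A) z = tr log(A) = Σ_μ log λ_μ` (`log A = cfc Real.log A`).
[cite: SaibabaAlexanderianIpsen2017, §1] [cite: GolubMeurant2010, §11.6.2] -/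
theorem hutchinson_mean_log (hA : A.IsHermitian) :
    ((2 : ℝ) ^ Fintype.card ι)⁻¹ * ∑ s : Finset ι, Hutchinson.sample (cfc Real.log A) s
      = ∑ μ, Real.log (hA.eigenvalues μ) := by
  rw [Hutchinson.hutchinson_mean, trace_cfc_eq_sum hA]
  simp only [RCLike.ofReal_real_eq_id, id_eq]

/-- **The `(k+1)`-step SLQ estimate of `log det A` with Rademacher probes OVER-estimates in exact
expectation**: `Σ_μ log λ_μ ≤ 2^{−n} Σ_s n (log J_s)₁₁` — probe by probe the Gauss value is an
upper bound (`LanczosGauss.LanczosRelation.star_dotProduct_log_mulVec_le`, GM Thm 6.3 with the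
sign reversed for `log`), and the average of the exact quadratic forms is `log det A`.
[cite: GolubMeurant2010, Thm 6.3, §11.6.2] [cite: ChenTrogdonUbaru2021, §1, §4.2]
[cite: SaibabaAlexanderianIpsen2017, §1] -/
theorem sum_log_le_slq_mean (hA : A.PosDef) (hL : ∀ s, LanczosRelation A (V s) (J s) (r s))
    (hz : ∀ s, signVec s = c • (V s).col 0) :
    ∑ μ, Real.log (hA.isHermitian.eigenvalues μ)
      ≤ ((2 : ℝ) ^ Fintype.card ι)⁻¹
          * ∑ s : Finset ι, (Fintype.card ι : ℝ) * cfc Real.log (J s) 0 0 := by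
  rw [← hutchinson_mean_log hA.isHermitian]
  refine mul_le_mul_of_nonneg_left (sum_le_sum fun s _ => ?_) (by positivity)
  rw [sample_eq_dotProduct, ← signVec_dotProduct_self s]
  have h := (hL s).star_dotProduct_log_mulVec_le hA (hz s)
  simpa only [star_trivial] using h

/-- **… and the Gauss–Radau variant UNDER-estimates**: with `J'_s` the Gauss–Radau modification
(prescribed node `0 < a ≤ λ_min(A)`) of each probe's Lanczos matrix,
`2^{−n} Σ_s n (log J'_s)₁₁ ≤ Σ_μ log λ_μ`.
[cite: GolubMeurant2010, Thm 6.4, §11.6.2, Thm 11.8] [cite: ChenTrogdonUbaru2021, §1, §4.2] -/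
theorem slqRadau_mean_le_sum_log (hA : A.PosDef) (hL : ∀ s, LanczosRelation A (V s) (J s) (r s))
    (hz : ∀ s, signVec s = c • (V s).col 0) {J' : Finset ι → Matrix (Fin (k + 1)) (Fin (k + 1)) ℝ}
    (hJ' : ∀ s, (J' s).IsHermitian) (heq : ∀ s, ∀ i j, j ≠ Fin.last k → J s i j = J' s i j)
    {a : ℝ} (ha0 : 0 < a) (ha : ∀ s, ∃ l, (hJ' s).eigenvalues l = a)
    (hev : ∀ μ, a ≤ hA.isHermitian.eigenvalues μ) :
    ((2 : ℝ) ^ Fintype.card ι)⁻¹ * ∑ s : Finset ι, (Fintype.card ι : ℝ) * cfc Real.log (J' s) 0 0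
      ≤ ∑ μ, Real.log (hA.isHermitian.eigenvalues μ) := by
  rw [← hutchinson_mean_log hA.isHermitian]
  refine mul_le_mul_of_nonneg_left (sum_le_sum fun s _ => ?_) (by positivity)
  rw [sample_eq_dotProduct, ← signVec_dotProduct_self s]
  have h := (hL s).le_star_dotProduct_log_mulVec hA (hJ' s) (heq s) ha0 (ha s) hev (hz s)
  simpa only [star_trivial] using h

end Literature.Probability.Moments.SLQ
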